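import Summits.QuantumFields.YangMills.Theorems.BalabanUVNodesN19BillFlagMoments
import Summits.QuantumFields.YangMills.Theorems.BalabanUVNodesSpineReadingOfRecord13CoPHK

/-!
# BalabanUVNodes ∕ node N19 (NE7) — THE BILL-FLAG SOCKET AT A KEY READING: at dag-n20-d's spine reading with a key-reading dial `crOfRecord₁₃KAt K₀ kr bd 0` whose bad-key reading
# `bd` reads a BILL THRESHOLD (`bd K u ↔ S_K < ū K u`), the N19′ ∧ N20 face bodies of K3⁷ stub 2 FOLLOW, in the reading's own canonical currency, from (Y) + ONE mean letter on the
# two-run RELATIVE bill at the coarse carriers + a Markov dial — N20's face PRODUCED, no one-run factorisation, no uniform modulus; the window dial of record is the named instance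

Cell `pub-ymgap` (HUMAN RULING D-0062 Track A ∕ D-0149 width seats), WIDTH SEAT `pub-ymgap-dag-n19-w1` (node n19 = NE7, seat 1 of 3), generation g5, CLAIM-4 ∕ INTENT-4.  Route
`Summits/QuantumFields/YangMills/Theses/BalabanUVNodes.lean`, key item K3⁷ `SpineGivenEndpointR13SepCoPH` (stmt-QuantumFields-20544; v5 941dddb108cbaacf stub 2 `stub_expansion13H`,
conjuncts N19′ `KeyedCoreEdgeHolderD4` ∧ N20 `KeyedRelWeight` at ONE reading; plan g83 WORDS-4 bookings (1)+(7) «re-key at the window key», v6 NOT cut); filed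
`--kind proof --supports … --as helper`.  COUNT-NEUTRAL.  THEOREMS ONLY (0 `def`, 0 `sorry`).  ADDITIVE — imports this seat's g5 `…Theorems.BalabanUVNodesN19BillFlagMoments` (CLAIM-3:
`hybridNE7_relBillFlag_of_meanRelBill`) and dag-n20-d's `…Theorems.BalabanUVNodesSpineReadingOfRecord13CoPHK` (p608328: `KeyReading₁₃ ∕ BadKeyReading₁₃ ∕ FloorReading₁₃`,
`crOfRecord₁₃KAt`, `classSetK₁₃ ∕ weightAK₁₃ ∕ weightBK₁₃ ∕ badClassK₁₃`, `mem_badClassK₁₃_iff`, `weightAK₁₃_nonneg ∕ weightBK₁₃_nonneg`, `relWeightBound_crOfRecord₁₃KAt`,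
`core_crOfRecord₁₃KAt`, `windowKeyReading₁₃`) ONLY; modifies nothing.

WHY.  g4's p620311 `faces_crOfRecord₁₃KAt_zeroShell_of_lawMergeLetters` typed the socket a window-key proof of the re-keyed stub fills, with THREE letter slots: (Y), the one-run
class form (D) with CLASS-UNIFORM moduli, and NE7b `RelWeightBound` for the flagged classes ASSUMED with the bad-key reading `bd` free.  g5's bill flag (p623522 ∕ FILE 3) removes
two of the three: the flag is the bill's own, N20's face is PRODUCED from a mean letter, and the bill is the two-run RELATIVE one (the only thing `Core` forces, p618673).  THIS FILE
reads that at the record object: the bad-key reading of the re-keyed stub may be taken to be «the class's relative bill exceeds `S_K`», and then the N19′ ∧ N20 pair at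
`crOfRecord₁₃KAt K₀ kr bd 0` asks exactly: (Y) + `Σ_u ū·weightAK₁₃ ≤ μ_K·Σ_u weightAK₁₃` (and `B`) + `Σ_K √(μ_K∕F.side⁴) < ∞`-type dial conditions.
* §0 [folklore] ★★ `hybridNE7_devFlag_of_meanDeviation` — FILE 3's relative bill flag with the common young factor `m_A = m_B = 1` ((Y) void): ONE constant `C_K` per step and a
  non-negative DEVIATION `u(τ)` with `e^{C_K − u}·A ≤ B ≤ e^{C_K + u}·A` on all classes + the two MEAN letters for `u` + a Markov dial ⇒ `HybridNE7 … {S < u} (μ∕S) 0 0 0 (S∕vol)`: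
  the whole two-run content of the zero-shell binder list is ONE first-moment letter on the log-ratio deviation (FILE 5: its root is sharp).
* §1 [bookkeeping] `badClassK₁₃_eq_filter_of_reads` (a `bd` reading the bill threshold at the tuple makes `badClassK₁₃` the bill flag `{S_K < ū}` at every step and source).
* §2 [bookkeeping] ★★★ `faces_crOfRecord₁₃KAt_zeroShell_of_meanRelBill` — ANY dial `kr`, ANY `bd` reading a bill threshold `S` for a source-uniform bill reading `ū ≥ 0`: (Y) `Core 1 F.side⁴
  classSetK₁₃ ∅ m_A m_B r` (`m_A > 0`, `m_B ≥ 0`) + the class-dependent CROSS sandwich `e^{C_K ∓ ū(u)}` of `weightAK₁₃·m_B` against `weightBK₁₃·m_A` + the two MEAN letters for `ū` +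
  non-negative fine weights + Markov dial (`S > 0`, `μ∕S < 1` summable, `Σ (S∕F.side⁴ + r) < ∞`) ⇒ `RelWeightBound cr… cr.W ∧ Core cr… cr.δ ∧ Summable cr.δ` at
  `cr := crOfRecord₁₃KAt K₀ kr bd 0` (FILE 3's `hybridNE7_relBillFlag_of_meanRelBill` + dag-n20-d's transfer lemmas BY NAME; the flag identified by §1, `▸`).
* §2b [bookkeeping] ★★★ `faces_crOfRecord₁₃KAt_zeroShell_of_meanDeviation` — §2 with `m_A = m_B = 1`: ONE constant `C_K` per step with
  `e^{C_K − ū(u)}·weightAK₁₃ ≤ weightBK₁₃ ≤ e^{C_K + ū(u)}·weightAK₁₃` on every coarse class and admissible source + the two MEAN letters for `ū` + non-negative fine weights + a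
  Markov dial ⇒ the N20 ∧ N19′ face bodies at `crOfRecord₁₃KAt K₀ kr bd 0` — the re-keyed pair asks ONE summable-after-root mean letter on the coarse weights' log-ratio deviation.
* §3 [bookkeeping] ★ `faces_windowReading_zeroShell_of_meanRelBill` — the instance at `windowKeyReading₁₃ K₀ c` (any floor reading `c`).
READINGS (located; nothing proposed).  (i) For a v6 text: a bad-key reading need not be a persistence ∕ size predicate typed in advance — «relative bill above threshold» is an
admissible `BadKeyReading₁₃`, and with it N20's conjunct at the reading is no separate obligation: it is Markov on the same mean letter that N19′ consumes.  (ii) What remains OPEN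
and unprinted is the pair of letters themselves for Bałaban's densities at the window-keyed carriers: (Y) and a summable-after-root MEAN relative bill.  (iii) Nothing here is
Bałaban's; no estimate is proved; `bd`, `ū`, `m_A`, `m_B`, `μ`, `S` are free readings ∕ letters.

HONEST FRAMING.  By-name bookkeeping over dag-n20-d's reading objects and this seat's g5 calculus; nothing of Bałaban's is asserted or instantiated; no estimate of the programme is
proved.  NE7 ∕ NE7b NOT PRINTED as two-run statements for d = 4 ∕ NOT proved; N19 ∕ N20 NOT discharged; K3⁷ OPEN, not claimed, v5 untouched; counts UNMOVED (typed 28∕28 ·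
discharged 5∕27, A 5∕28).  Everything below is PROVED (0 `sorry`, 0 named facts, standard axioms); no decl carries a cite tag.  One finite four-torus programme at fixed ε — NOT ℝ⁴,
NOT infinite volume, NOT OS, NOT a mass gap, NOT the Clay problem (R4 closes the conditional finite-𝕋⁴ rung `BalabanLadder.UV` only).
-/

noncomputable section

open Finset
open scoped BigOperators

namespace Summit.QuantumFields.YangMills.BalabanUVNodes.N19BillFlagSocketAtKeyReading

open Summit.QuantumFields.BalabanUV.T4Continuum.Spine.NE7 (Core)
open Literature.MathematicalPhysics.QuantumFieldTheory.Balaban1983to89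
open Literature.MathematicalPhysics.QuantumFieldTheory.Balaban1983to89.T4Continuum
open Literature.MathematicalPhysics.QuantumFieldTheory.Balaban1983to89.Node00
open T4WeightBudget (RelWeightBound)
open T4MatchingAssembly (HybridNE7)
open YMDAG.UVSplit
open Summit.QuantumFields.YangMills.BalabanUVNodes.N19BillFlagMoments (hybridNE7_relBillFlag_of_meanRelBill)

variable {F : T4Family} {N : ℕ} [NeZero N] (K₀ : ℕ) (kr : KeyReading₁₃ N K₀) (bd : BadKeyReading₁₃ N K₀) (θ : Stage13HParams F N) (hP : θ.Provisos₁₃CoPH F N)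
  (g₀ : ℕ → ℝ) (os : List (ULoop F))

/-! ## §0 The deviation form of FILE 3 §2: ONE mean letter on the two-run LOG-RATIO DEVIATION [folklore] -/

section Deviation
variable {ι : Type*} [DecidableEq ι] {l₀ vol : ℝ} {T : ℕ → Finset ι} {A B u : ℕ → ℝ → ι → ℝ} {S μ : ℕ → ℝ}

/-- **★★ THE DEVIATION FLAG** [folklore] (FILE 3 `hybridNE7_relBillFlag_of_meanRelBill` with the common young factor `m_A = m_B = 1`, so that (Y) is void): per level ONE constant
`C_K` and a class-dependent, non-negative DEVIATION `u(τ)` of the two-run log-ratio from it, `e^{C_K − u(τ)}·A ≤ B ≤ e^{C_K + u(τ)}·A` on all classes; the two MEAN letters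
`Σ_τ u·A ≤ μ_K·Σ_τ A`, `Σ_τ u·B ≤ μ_K·Σ_τ B`; a Markov dial `S_K > 0` with `μ∕S < 1` summable and `Σ S_K∕vol < ∞` ⇒ the complete zero-shell binder list
`HybridNE7 l₀ vol T A B {S < u} (μ∕S) 0 0 0 (S∕vol)`.  The whole two-run content is ONE first-moment letter on the log-ratio deviation (FILE 5: the root it costs is sharp). -/
theorem hybridNE7_devFlag_of_meanDeviation (hvol : 0 < vol)
    (hA0 : ∀ (K : ℕ) (t : ℝ), |t| ≤ l₀ → ∀ τ ∈ T K, 0 ≤ A K t τ) (hB0 : ∀ (K : ℕ) (t : ℝ), |t| ≤ l₀ → ∀ τ ∈ T K, 0 ≤ B K t τ)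
    (hdev : ∀ K : ℕ, ∃ C : ℝ, ∀ t : ℝ, |t| ≤ l₀ → ∀ τ ∈ T K,
      Real.exp (C - u K t τ) * A K t τ ≤ B K t τ ∧ B K t τ ≤ Real.exp (C + u K t τ) * A K t τ)
    (hu0 : ∀ (K : ℕ) (t : ℝ), |t| ≤ l₀ → ∀ τ ∈ T K, 0 ≤ u K t τ)
    (hμA : ∀ (K : ℕ) (t : ℝ), |t| ≤ l₀ → ∑ τ ∈ T K, u K t τ * A K t τ ≤ μ K * ∑ τ ∈ T K, A K t τ)
    (hμB : ∀ (K : ℕ) (t : ℝ), |t| ≤ l₀ → ∑ τ ∈ T K, u K t τ * B K t τ ≤ μ K * ∑ τ ∈ T K, B K t τ)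
    (hS : ∀ K, 0 < S K) (hμ0 : ∀ K, 0 ≤ μ K) (hlt : ∀ K, μ K / S K < 1) (hμS : Summable fun K => μ K / S K) (hrad : Summable fun K => S K / vol) :
    HybridNE7 l₀ vol T A B (fun K t => (T K).filter fun τ => S K < u K t τ) (fun K => μ K / S K)
      (fun _ _ _ => 0) (fun _ _ _ => 0) (fun _ => 0) (fun K => S K / vol) := by
  have hy : Core l₀ vol T (fun _ _ => ∅) (fun _ _ _ => (1 : ℝ)) (fun _ _ _ => (1 : ℝ)) (fun _ => 0) :=
    fun K => ⟨0, fun t _ τ _ => by simp⟩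
  have h := hybridNE7_relBillFlag_of_meanRelBill (mA := fun _ _ _ => (1 : ℝ)) (mB := fun _ _ _ => (1 : ℝ)) (r := fun _ => 0) hvol hA0 hB0
    (fun _ _ _ _ _ => one_pos) (fun _ _ _ _ _ => zero_le_one) hy
    (fun K => by
      obtain ⟨C, hC⟩ := hdev K
      exact ⟨C, fun t ht τ hτ => by simpa only [mul_one] using hC t ht τ hτ⟩)
    hu0 hμA hμB hS hμ0 hlt hμS (by simpa using hrad)
  simpa only [add_zero] using h

end Deviation

/-! ## §1 A bad-key reading that reads a bill threshold at the tuple IS the bill flag there [bookkeeping] -/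

/-- If at this tuple the bad-key reading `bd` reads «the class's bill exceeds the threshold», `bd K u ↔ S_K < ū K u`, then the coarse bad class of record at every step and source IS
the bill flag `{u ∈ classSetK₁₃ | S_K < ū K u}`. [bookkeeping] -/
theorem badClassK₁₃_eq_filter_of_reads {S : ℕ → ℝ} {ubar : ℕ → (Σ K, SiteSeqKey F (K₀ + K)) → ℝ}
    (hbd : ∀ (K : ℕ) (u : Σ K, SiteSeqKey F (K₀ + K)), bd F θ hP g₀ os K u ↔ S K < ubar K u) (K : ℕ) (t : ℝ) :
    badClassK₁₃ θ K₀ g₀ (kr F θ hP g₀ os) (bd F θ hP g₀ os) K t = (classSetK₁₃ θ K₀ g₀ (kr F θ hP g₀ os) K).filter fun u => S K < ubar K u := by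
  ext u
  rw [mem_badClassK₁₃_iff, Finset.mem_filter, hbd]

/-! ## §2 The socket: (Y) + a MEAN letter on the two-run RELATIVE bill at the coarse carriers ⇒ the N20 ∧ N19′ face bodies at `crOfRecord₁₃KAt K₀ kr bd 0` [bookkeeping] -/

/-- **★★★ THE BILL-FLAG SOCKET AT A KEY READING** [bookkeeping].  At one tuple, for ANY dial `kr` and ANY bad-key reading `bd` that reads a bill threshold there
(`bd K u ↔ S_K < ū K u`): from (Y) young class factors `m_A > 0`, `m_B ≥ 0` `Core`-matched on ALL coarse classes at a radius `r`; ONE constant `C_K` per step with the coarse class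
weights' CROSS products sandwiched class-dependently and source-uniformly, `e^{C_K − ū(u)}·(weightAK₁₃·m_B) ≤ weightBK₁₃·m_A ≤ e^{C_K + ū(u)}·(weightAK₁₃·m_B)` (`ū ≥ 0` = the
two-run RELATIVE bill of the coarse class, read uniformly in `|t| ≤ 1`); the two MEAN letters `Σ_u ū·weightAK₁₃ ≤ μ_K·Σ_u weightAK₁₃`, `Σ_u ū·weightBK₁₃ ≤ μ_K·Σ_u weightBK₁₃`
(`μ_K ≥ 0`); non-negative fine class weights of record; and a Markov dial `S_K > 0` with `μ_K∕S_K < 1` summable and `Σ_K (S_K∕F.side⁴ + r_K) < ∞` — the reading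
`crOfRecord₁₃KAt K₀ kr bd 0` (ZERO shell split) carries `RelWeightBound` with its canonical `W` AND `Core` with its canonical `δ`, summable: the N20 and N19′ face bodies of stub 2
at that reading (g5 `…N19BillFlagMoments.hybridNE7_relBillFlag_of_meanRelBill` + dag-n20-d's `relWeightBound_crOfRecord₁₃KAt` ∕ `core_crOfRecord₁₃KAt` BY NAME).  NO one-run
factorisation, NO old scalar, NO class-uniform modulus, NO separately assumed N20 letter: the flag is the bill's own and N20's face is PRODUCED from the mean. -/
theorem faces_crOfRecord₁₃KAt_zeroShell_of_meanRelBill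
    {mA mB : ℕ → ℝ → (Σ K, SiteSeqKey F (K₀ + K)) → ℝ} {ubar : ℕ → (Σ K, SiteSeqKey F (K₀ + K)) → ℝ} {r S μ : ℕ → ℝ}
    (hbd : ∀ (K : ℕ) (u : Σ K, SiteSeqKey F (K₀ + K)), bd F θ hP g₀ os K u ↔ S K < ubar K u)
    (hmA : ∀ (K : ℕ) (t : ℝ), |t| ≤ 1 → ∀ u ∈ classSetK₁₃ θ K₀ g₀ (kr F θ hP g₀ os) K, 0 < mA K t u)
    (hmB : ∀ (K : ℕ) (t : ℝ), |t| ≤ 1 → ∀ u ∈ classSetK₁₃ θ K₀ g₀ (kr F θ hP g₀ os) K, 0 ≤ mB K t u)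
    (hyoung : letI : DecidableEq (Σ K, SiteSeqKey F (K₀ + K)) := Classical.decEq _
      Core 1 ((F.side : ℝ) ^ 4) (classSetK₁₃ θ K₀ g₀ (kr F θ hP g₀ os)) (fun _ _ => ∅) mA mB r)
    (hrel : ∀ K : ℕ, ∃ C : ℝ, ∀ t : ℝ, |t| ≤ 1 → ∀ u ∈ classSetK₁₃ θ K₀ g₀ (kr F θ hP g₀ os) K,
      Real.exp (C - ubar K u) * (weightAK₁₃ θ hP K₀ g₀ os (kr F θ hP g₀ os) K t u * mB K t u) ≤ weightBK₁₃ θ hP K₀ g₀ os (kr F θ hP g₀ os) K t u * mA K t u ∧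
        weightBK₁₃ θ hP K₀ g₀ os (kr F θ hP g₀ os) K t u * mA K t u ≤ Real.exp (C + ubar K u) * (weightAK₁₃ θ hP K₀ g₀ os (kr F θ hP g₀ os) K t u * mB K t u))
    (hu0 : ∀ (K : ℕ), ∀ u ∈ classSetK₁₃ θ K₀ g₀ (kr F θ hP g₀ os) K, 0 ≤ ubar K u)
    (hμA : ∀ (K : ℕ) (t : ℝ), |t| ≤ 1 → ∑ u ∈ classSetK₁₃ θ K₀ g₀ (kr F θ hP g₀ os) K, ubar K u * weightAK₁₃ θ hP K₀ g₀ os (kr F θ hP g₀ os) K t u ≤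
      μ K * ∑ u ∈ classSetK₁₃ θ K₀ g₀ (kr F θ hP g₀ os) K, weightAK₁₃ θ hP K₀ g₀ os (kr F θ hP g₀ os) K t u)
    (hμB : ∀ (K : ℕ) (t : ℝ), |t| ≤ 1 → ∑ u ∈ classSetK₁₃ θ K₀ g₀ (kr F θ hP g₀ os) K, ubar K u * weightBK₁₃ θ hP K₀ g₀ os (kr F θ hP g₀ os) K t u ≤
      μ K * ∑ u ∈ classSetK₁₃ θ K₀ g₀ (kr F θ hP g₀ os) K, weightBK₁₃ θ hP K₀ g₀ os (kr F θ hP g₀ os) K t u)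
    (hA0 : ∀ (K : ℕ) (t : ℝ), |t| ≤ 1 → ∀ x ∈ classSet₁₃ θ K₀ g₀ K, 0 ≤ weightA₁₃ θ hP K₀ g₀ os K t x)
    (hB0 : ∀ (K : ℕ) (t : ℝ), |t| ≤ 1 → ∀ x ∈ classSet₁₃ θ K₀ g₀ K, 0 ≤ weightB₁₃ θ hP K₀ g₀ os K t x)
    (hS : ∀ K, 0 < S K) (hμ0 : ∀ K, 0 ≤ μ K) (hlt : ∀ K, μ K / S K < 1) (hμS : Summable fun K => μ K / S K)
    (hrad : Summable fun K => S K / ((F.side : ℝ) ^ 4) + r K) :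
    let cr := crOfRecord₁₃KAt K₀ kr bd (fun _ _ _ _ _ => (fun _ _ _ => 0, fun _ _ _ => 0)) F θ hP g₀ os
    RelWeightBound cr.l₀ cr.T cr.A cr.B cr.Bad cr.W ∧
      (letI := cr.dec
       Core cr.l₀ cr.vol cr.T cr.Bad (fun K t τ => cr.A K t τ - cr.shA K t τ) (fun K t τ => cr.B K t τ - cr.shB K t τ) cr.δ) ∧ Summable cr.δ := by
  letI iS : DecidableEq (Σ K, SiteSeqKey F (K₀ + K)) := Classical.decEq _
  have hvol : (0 : ℝ) < (F.side : ℝ) ^ 4 := pow_pos F.side_pos 4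
  have hAK0 : ∀ (K : ℕ) (t : ℝ), |t| ≤ 1 → ∀ u ∈ classSetK₁₃ θ K₀ g₀ (kr F θ hP g₀ os) K, 0 ≤ weightAK₁₃ θ hP K₀ g₀ os (kr F θ hP g₀ os) K t u :=
    fun K t ht u _ => weightAK₁₃_nonneg θ hP K₀ g₀ os (kr F θ hP g₀ os) (hA0 K t ht) u
  have hBK0 : ∀ (K : ℕ) (t : ℝ), |t| ≤ 1 → ∀ u ∈ classSetK₁₃ θ K₀ g₀ (kr F θ hP g₀ os) K, 0 ≤ weightBK₁₃ θ hP K₀ g₀ os (kr F θ hP g₀ os) K t u :=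
    fun K t ht u _ => weightBK₁₃_nonneg θ hP K₀ g₀ os (kr F θ hP g₀ os) (hB0 K t ht) u
  -- the complete binder list at the coarse carriers with the bill flag (g5 FILE 3 BY NAME)
  have h := hybridNE7_relBillFlag_of_meanRelBill (l₀ := 1) (u := fun K _ u => ubar K u) hvol hAK0 hBK0 hmA hmB hyoung hrel (fun K _ _ u hu => hu0 K u hu) hμA hμB hS hμ0 hlt
    hμS hrad
  -- the record's coarse bad class IS the bill flag at this tuple
  have e : (fun K t => (classSetK₁₃ θ K₀ g₀ (kr F θ hP g₀ os) K).filter fun u => S K < ubar K u) =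
      badClassK₁₃ θ K₀ g₀ (kr F θ hP g₀ os) (bd F θ hP g₀ os) :=
    funext fun K => funext fun t => (badClassK₁₃_eq_filter_of_reads K₀ kr bd θ hP g₀ os hbd K t).symm
  have hW : RelWeightBound 1 (classSetK₁₃ θ K₀ g₀ (kr F θ hP g₀ os)) (weightAK₁₃ θ hP K₀ g₀ os (kr F θ hP g₀ os)) (weightBK₁₃ θ hP K₀ g₀ os (kr F θ hP g₀ os))
      (badClassK₁₃ θ K₀ g₀ (kr F θ hP g₀ os) (bd F θ hP g₀ os)) (fun K => μ K / S K) := e ▸ h.weight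
  have hcore : Core 1 ((F.side : ℝ) ^ 4) (classSetK₁₃ θ K₀ g₀ (kr F θ hP g₀ os)) (badClassK₁₃ θ K₀ g₀ (kr F θ hP g₀ os) (bd F θ hP g₀ os))
      (fun K t u => weightAK₁₃ θ hP K₀ g₀ os (kr F θ hP g₀ os) K t u - (0 : ℝ)) (fun K t u => weightBK₁₃ θ hP K₀ g₀ os (kr F θ hP g₀ os) K t u - (0 : ℝ))
      (fun K => S K / ((F.side : ℝ) ^ 4) + r K) := by
    have hc := h.core
    simp only [sub_zero] at hc ⊢
    exact e ▸ hc
  have hP0 : ∀ (K : ℕ) (t : ℝ), |t| ≤ 1 → ∀ u ∈ classSetK₁₃ θ K₀ g₀ (kr F θ hP g₀ os) K \ badClassK₁₃ θ K₀ g₀ (kr F θ hP g₀ os) (bd F θ hP g₀ os) K t,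
      0 ≤ weightAK₁₃ θ hP K₀ g₀ os (kr F θ hP g₀ os) K t u - (0 : ℝ) := fun K t ht u hu => by
    rw [sub_zero]
    exact weightAK₁₃_nonneg θ hP K₀ g₀ os (kr F θ hP g₀ os) (hA0 K t ht) u
  exact ⟨relWeightBound_crOfRecord₁₃KAt K₀ kr bd _ θ hP g₀ os hW, core_crOfRecord₁₃KAt K₀ kr bd _ θ hP g₀ os hP0 hcore hrad⟩

/-! ### §2b The same socket in DEVIATION form: one letter on the coarse class weights' two-run log-ratio [bookkeeping] -/

/-- **★★★ THE DEVIATION SOCKET AT A KEY READING** [bookkeeping] (§2 with `m_A = m_B = 1`): ANY dial `kr`, ANY bad-key reading `bd` reading a threshold `S` for a source-uniform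
reading `ū ≥ 0`; ONE constant `C_K` per step with `e^{C_K − ū(u)}·weightAK₁₃ ≤ weightBK₁₃ ≤ e^{C_K + ū(u)}·weightAK₁₃` on every coarse class and admissible source; the two MEAN
letters for `ū`; non-negative fine weights; Markov dial (`μ∕S < 1` summable, `Σ S∕F.side⁴ < ∞`) ⇒ the N20 ∧ N19′ face bodies at `crOfRecord₁₃KAt K₀ kr bd 0`.  The re-keyed stub's
N19′ ∧ N20 pair at a window key thus asks ONE thing of the two runs' coarse class weights: a summable-after-root MEAN of their log-ratio deviation from one constant per step. -/
theorem faces_crOfRecord₁₃KAt_zeroShell_of_meanDeviation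
    {ubar : ℕ → (Σ K, SiteSeqKey F (K₀ + K)) → ℝ} {S μ : ℕ → ℝ}
    (hbd : ∀ (K : ℕ) (u : Σ K, SiteSeqKey F (K₀ + K)), bd F θ hP g₀ os K u ↔ S K < ubar K u)
    (hdev : ∀ K : ℕ, ∃ C : ℝ, ∀ t : ℝ, |t| ≤ 1 → ∀ u ∈ classSetK₁₃ θ K₀ g₀ (kr F θ hP g₀ os) K,
      Real.exp (C - ubar K u) * weightAK₁₃ θ hP K₀ g₀ os (kr F θ hP g₀ os) K t u ≤ weightBK₁₃ θ hP K₀ g₀ os (kr F θ hP g₀ os) K t u ∧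
        weightBK₁₃ θ hP K₀ g₀ os (kr F θ hP g₀ os) K t u ≤ Real.exp (C + ubar K u) * weightAK₁₃ θ hP K₀ g₀ os (kr F θ hP g₀ os) K t u)
    (hu0 : ∀ (K : ℕ), ∀ u ∈ classSetK₁₃ θ K₀ g₀ (kr F θ hP g₀ os) K, 0 ≤ ubar K u)
    (hμA : ∀ (K : ℕ) (t : ℝ), |t| ≤ 1 → ∑ u ∈ classSetK₁₃ θ K₀ g₀ (kr F θ hP g₀ os) K, ubar K u * weightAK₁₃ θ hP K₀ g₀ os (kr F θ hP g₀ os) K t u ≤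
      μ K * ∑ u ∈ classSetK₁₃ θ K₀ g₀ (kr F θ hP g₀ os) K, weightAK₁₃ θ hP K₀ g₀ os (kr F θ hP g₀ os) K t u)
    (hμB : ∀ (K : ℕ) (t : ℝ), |t| ≤ 1 → ∑ u ∈ classSetK₁₃ θ K₀ g₀ (kr F θ hP g₀ os) K, ubar K u * weightBK₁₃ θ hP K₀ g₀ os (kr F θ hP g₀ os) K t u ≤
      μ K * ∑ u ∈ classSetK₁₃ θ K₀ g₀ (kr F θ hP g₀ os) K, weightBK₁₃ θ hP K₀ g₀ os (kr F θ hP g₀ os) K t u)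
    (hA0 : ∀ (K : ℕ) (t : ℝ), |t| ≤ 1 → ∀ x ∈ classSet₁₃ θ K₀ g₀ K, 0 ≤ weightA₁₃ θ hP K₀ g₀ os K t x)
    (hB0 : ∀ (K : ℕ) (t : ℝ), |t| ≤ 1 → ∀ x ∈ classSet₁₃ θ K₀ g₀ K, 0 ≤ weightB₁₃ θ hP K₀ g₀ os K t x)
    (hS : ∀ K, 0 < S K) (hμ0 : ∀ K, 0 ≤ μ K) (hlt : ∀ K, μ K / S K < 1) (hμS : Summable fun K => μ K / S K)
    (hrad : Summable fun K => S K / ((F.side : ℝ) ^ 4)) :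
    let cr := crOfRecord₁₃KAt K₀ kr bd (fun _ _ _ _ _ => (fun _ _ _ => 0, fun _ _ _ => 0)) F θ hP g₀ os
    RelWeightBound cr.l₀ cr.T cr.A cr.B cr.Bad cr.W ∧
      (letI := cr.dec
       Core cr.l₀ cr.vol cr.T cr.Bad (fun K t τ => cr.A K t τ - cr.shA K t τ) (fun K t τ => cr.B K t τ - cr.shB K t τ) cr.δ) ∧ Summable cr.δ := by
  letI iS : DecidableEq (Σ K, SiteSeqKey F (K₀ + K)) := Classical.decEq _
  have hy : Core 1 ((F.side : ℝ) ^ 4) (classSetK₁₃ θ K₀ g₀ (kr F θ hP g₀ os)) (fun _ _ => ∅) (fun _ _ _ => (1 : ℝ)) (fun _ _ _ => (1 : ℝ)) (fun _ => 0) :=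
    fun K => ⟨0, fun t _ τ _ => by simp⟩
  have h := faces_crOfRecord₁₃KAt_zeroShell_of_meanRelBill K₀ kr bd θ hP g₀ os (mA := fun _ _ _ => (1 : ℝ)) (mB := fun _ _ _ => (1 : ℝ)) (r := fun _ => 0) hbd
    (fun _ _ _ _ _ => one_pos) (fun _ _ _ _ _ => zero_le_one) hy
    (fun K => by
      obtain ⟨C, hC⟩ := hdev K
      exact ⟨C, fun t ht u hu => by simpa only [mul_one] using hC t ht u hu⟩)
    hu0 hμA hμB hA0 hB0 hS hμ0 hlt hμS (by simpa using hrad)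
  exact h

/-! ## §3 The instance at the window dial of record [bookkeeping] -/

/-- **★ THE SAME AT THE LEVEL-WINDOW DIAL `windowKeyReading₁₃ K₀ c`** [bookkeeping] (dag-n20-d's window VALUE of the dial, floor reading `c`; ANY bad-key reading `bd` reading a bill
threshold at the tuple): (Y) + the mean RELATIVE-bill letters at the window-keyed coarse carriers + a Markov dial ⇒ the N20 ∧ N19′ face bodies at
`crOfRecord₁₃KAt K₀ (windowKeyReading₁₃ K₀ c) bd 0`. -/
theorem faces_windowReading_zeroShell_of_meanRelBill (c : FloorReading₁₃ N)
    {mA mB : ℕ → ℝ → (Σ K, SiteSeqKey F (K₀ + K)) → ℝ} {ubar : ℕ → (Σ K, SiteSeqKey F (K₀ + K)) → ℝ} {r S μ : ℕ → ℝ}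
    (hbd : ∀ (K : ℕ) (u : Σ K, SiteSeqKey F (K₀ + K)), bd F θ hP g₀ os K u ↔ S K < ubar K u)
    (hmA : ∀ (K : ℕ) (t : ℝ), |t| ≤ 1 → ∀ u ∈ classSetK₁₃ θ K₀ g₀ (fun _ x => windowKeySigma F (c F θ hP g₀ os) x) K, 0 < mA K t u)
    (hmB : ∀ (K : ℕ) (t : ℝ), |t| ≤ 1 → ∀ u ∈ classSetK₁₃ θ K₀ g₀ (fun _ x => windowKeySigma F (c F θ hP g₀ os) x) K, 0 ≤ mB K t u)
    (hyoung : letI : DecidableEq (Σ K, SiteSeqKey F (K₀ + K)) := Classical.decEq _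
      Core 1 ((F.side : ℝ) ^ 4) (classSetK₁₃ θ K₀ g₀ (fun _ x => windowKeySigma F (c F θ hP g₀ os) x)) (fun _ _ => ∅) mA mB r)
    (hrel : ∀ K : ℕ, ∃ C : ℝ, ∀ t : ℝ, |t| ≤ 1 → ∀ u ∈ classSetK₁₃ θ K₀ g₀ (fun _ x => windowKeySigma F (c F θ hP g₀ os) x) K,
      Real.exp (C - ubar K u) * (weightAK₁₃ θ hP K₀ g₀ os (fun _ x => windowKeySigma F (c F θ hP g₀ os) x) K t u * mB K t u) ≤ weightBK₁₃ θ hP K₀ g₀ os (fun _ x => windowKeySigma F (c F θ hP g₀ os) x) K t u * mA K t u ∧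
        weightBK₁₃ θ hP K₀ g₀ os (fun _ x => windowKeySigma F (c F θ hP g₀ os) x) K t u * mA K t u ≤ Real.exp (C + ubar K u) * (weightAK₁₃ θ hP K₀ g₀ os (fun _ x => windowKeySigma F (c F θ hP g₀ os) x) K t u * mB K t u))
    (hu0 : ∀ (K : ℕ), ∀ u ∈ classSetK₁₃ θ K₀ g₀ (fun _ x => windowKeySigma F (c F θ hP g₀ os) x) K, 0 ≤ ubar K u)
    (hμA : ∀ (K : ℕ) (t : ℝ), |t| ≤ 1 → ∑ u ∈ classSetK₁₃ θ K₀ g₀ (fun _ x => windowKeySigma F (c F θ hP g₀ os) x) K, ubar K u * weightAK₁₃ θ hP K₀ g₀ os (fun _ x => windowKeySigma F (c F θ hP g₀ os) x) K t u ≤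
      μ K * ∑ u ∈ classSetK₁₃ θ K₀ g₀ (fun _ x => windowKeySigma F (c F θ hP g₀ os) x) K, weightAK₁₃ θ hP K₀ g₀ os (fun _ x => windowKeySigma F (c F θ hP g₀ os) x) K t u)
    (hμB : ∀ (K : ℕ) (t : ℝ), |t| ≤ 1 → ∑ u ∈ classSetK₁₃ θ K₀ g₀ (fun _ x => windowKeySigma F (c F θ hP g₀ os) x) K, ubar K u * weightBK₁₃ θ hP K₀ g₀ os (fun _ x => windowKeySigma F (c F θ hP g₀ os) x) K t u ≤
      μ K * ∑ u ∈ classSetK₁₃ θ K₀ g₀ (fun _ x => windowKeySigma F (c F θ hP g₀ os) x) K, weightBK₁₃ θ hP K₀ g₀ os (fun _ x => windowKeySigma F (c F θ hP g₀ os) x) K t u)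
    (hA0 : ∀ (K : ℕ) (t : ℝ), |t| ≤ 1 → ∀ x ∈ classSet₁₃ θ K₀ g₀ K, 0 ≤ weightA₁₃ θ hP K₀ g₀ os K t x)
    (hB0 : ∀ (K : ℕ) (t : ℝ), |t| ≤ 1 → ∀ x ∈ classSet₁₃ θ K₀ g₀ K, 0 ≤ weightB₁₃ θ hP K₀ g₀ os K t x)
    (hS : ∀ K, 0 < S K) (hμ0 : ∀ K, 0 ≤ μ K) (hlt : ∀ K, μ K / S K < 1) (hμS : Summable fun K => μ K / S K)
    (hrad : Summable fun K => S K / ((F.side : ℝ) ^ 4) + r K) :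
    let cr := crOfRecord₁₃KAt K₀ (windowKeyReading₁₃ K₀ c) bd (fun _ _ _ _ _ => (fun _ _ _ => 0, fun _ _ _ => 0)) F θ hP g₀ os
    RelWeightBound cr.l₀ cr.T cr.A cr.B cr.Bad cr.W ∧
      (letI := cr.dec
       Core cr.l₀ cr.vol cr.T cr.Bad (fun K t τ => cr.A K t τ - cr.shA K t τ) (fun K t τ => cr.B K t τ - cr.shB K t τ) cr.δ) ∧ Summable cr.δ :=
  faces_crOfRecord₁₃KAt_zeroShell_of_meanRelBill K₀ (windowKeyReading₁₃ K₀ c) bd θ hP g₀ os hbd hmA hmB hyoung hrel hu0 hμA hμB hA0 hB0 hS hμ0 hlt hμS hrad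

end Summit.QuantumFields.YangMills.BalabanUVNodes.N19BillFlagSocketAtKeyReading
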